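import Mathlib

/-!
# NegationLens6g12 — algebraic cores of THEOREM Π (memo `NEGATION-lens6-g12.md`, §2)

unit res-B-lens-6 g12 · crux stmt-ResolutionOfSingularities-0549 `Theses.Descent.DescentPerfectToAll` ·
bears_on: LADDER-RESOLUTION:B · [OURS · CANDIDATE] counted 0 · **nothing in this file proves resolution of
singularities in positive characteristic**, and nothing here touches the statement, rank or glue of 0549.

The memo's THEOREM Π is a hand argument about the restriction `Ḡ` of the Kummer radicand to the
maximal-contact surface along a valuation.  Its polynomial cores, certified here over an arbitrary
commutative ring / field of characteristic `p`:

* `K12_*`  — Frobenius coefficient law `(b^p).coeff n = [p ∣ n]·(b.coeff (n/p))^p` and its two uses in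
  Lemma 2.2: the `u′^N`-coefficient of `G − b^p` is non-zero when `G.coeff N` is no `p`-th power
  (so a removed level `X^M ∣ G − b^p` has `M ≤ N`), and below `N` every coefficient of `G − b^p` is a
  `p`-th power (a W-invariant level bears nothing).  (cf. the tree's `…S04CharAlgebra.QhPure.coeff_frobenius_pow`.)
* `K13_*`  — the descent arithmetic of 2.4/2.5 and «no infinite strictly decreasing ℕ-sequence».
* `K14_*`  — `natDegree f ≤ N`, `p ∣ N` ⇒ `natDegree f′ ≤ N − 2`, hence every root of `f′ ≠ 0` has
  multiplicity `≤ N − 2` (the bound `Π_{e_x}(x′) ≤ N*(x) − 1`).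
* `K15_*`  — `(g^p · f)′ = g^p · f′` (the `ε^p` factors of 2.3 do not move critical points).
* `K16_*`  — over a perfect field, `f′ = 0 ⇒ f = g^p` (contrapositive of «p-prepared ⇒ P′ ≢ 0», 2.1/Δ3).

Mathlib only; no `sorry`.
-/

set_option linter.dupNamespace false

namespace Summit.ResolutionOfSingularities.ResolutionOfSingularities.Cruxes.DescentPerfectToAll.NegationLens6g12

open Polynomial

/-! ### K12: Frobenius coefficient law and the bearing level (memo 2.1, 2.2) -/
section K12
variable {S : Type*} [CommRing S] (p : ℕ) [hp : Fact p.Prime] [CharP S p]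

/-- K12a: in characteristic `p`, `(b^p).coeff n = (b.coeff (n/p))^p` if `p ∣ n`, else `0`. -/
theorem K12_coeff_pow_p (b : S[X]) (n : ℕ) :
    (b ^ p).coeff n = if p ∣ n then (b.coeff (n / p)) ^ p else 0 := by
  rw [← Polynomial.map_frobenius_expand (p := p), Polynomial.coeff_map,
    Polynomial.coeff_expand hp.out.pos]
  by_cases h : p ∣ n
  · rw [if_pos h, if_pos h, frobenius_def]
  · rw [if_neg h, if_neg h, map_zero]

/-- K12b: coefficients of `b^p` in degrees not divisible by `p` vanish. -/
theorem K12_coeff_pow_p_of_not_dvd (b : S[X]) {n : ℕ} (hn : ¬ p ∣ n) : (b ^ p).coeff n = 0 := by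
  rw [K12_coeff_pow_p p b n, if_neg hn]

/-- K12c: `(b^p).coeff (p*m) = (b.coeff m)^p`. -/
theorem K12_coeff_pow_p_mul (b : S[X]) (m : ℕ) : (b ^ p).coeff (p * m) = (b.coeff m) ^ p := by
  rw [K12_coeff_pow_p p b, if_pos (dvd_mul_right p m), Nat.mul_div_cancel_left m hp.out.pos]

/-- K12d (memo 2.2 a, the non-vanishing step): if the degree-`N` coefficient of `G` is no `p`-th power
(for `p ∤ N` this just says it is non-zero, taking `β = 0`), then no translation by a `p`-th power
kills it: `(G − b^p).coeff N ≠ 0`. -/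
theorem K12_bearing_coeff_ne_zero (G b : S[X]) (N : ℕ) (hN : ∀ β : S, G.coeff N ≠ β ^ p) :
    (G - b ^ p).coeff N ≠ 0 := by
  rw [coeff_sub, K12_coeff_pow_p p b N]
  by_cases h : p ∣ N
  · rw [if_pos h]; intro h0; exact hN (b.coeff (N / p)) (sub_eq_zero.mp h0)
  · rw [if_neg h, sub_zero]; intro h0
    exact hN 0 (by rw [h0, zero_pow hp.out.ne_zero])

/-- K12e (memo 2.2 a): hence a removed level `M` with `X^M ∣ G − b^p` satisfies `M ≤ N`. -/
theorem K12_level_le (G b : S[X]) (N M : ℕ) (hN : ∀ β : S, G.coeff N ≠ β ^ p)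
    (hdiv : X ^ M ∣ (G - b ^ p)) : M ≤ N := by
  by_contra h
  rw [not_le] at h
  exact K12_bearing_coeff_ne_zero p G b N hN (Polynomial.X_pow_dvd_iff.mp hdiv N h)

/-- K12f (memo 2.2 b): below the p-free order `N` (where `G` has no coefficients) every coefficient of
`G − b^p` is a `p`-th power — the restriction to the line at such a level is a `p`-th power, the line is
W-invariant there and bears no birth. -/
theorem K12_below_level_pth_power (G b : S[X]) (N M : ℕ) (hG : ∀ n, n < N → G.coeff n = 0)
    (hM : M < N) : ∃ γ : S, (G - b ^ p).coeff M = γ ^ p := by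
  rw [coeff_sub, hG M hM, zero_sub, K12_coeff_pow_p p b M]
  by_cases h : p ∣ M
  · rw [if_pos h]
    exact ⟨-(b.coeff (M / p)), by rw [neg_pow, neg_one_pow_char S p, neg_one_mul]⟩
  · rw [if_neg h, neg_zero]
    exact ⟨0, by rw [zero_pow hp.out.ne_zero]⟩

end K12

/-! ### K13: the descent arithmetic (memo 2.4, 2.5) -/
section K13

/-- K13a: with `N ≤ Π` (2.4 i), `Π_e ≤ N − 1` (2.4 ii), `Π_ℓ′ = Π_ℓ − pM` with `Π_ℓ ≤ Π` and `p ≤ pM`,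
`1 ≤ p` (2.4 iii), the new potential `Π' ≤ max Π_e Π_ℓ′` satisfies `Π' + 1 ≤ Π`. -/
theorem K13_descent (Pi Pi' N Pe Pl Pl' pM p : ℕ) (hp : 1 ≤ p) (hN : N ≤ Pi)
    (he : Pe + 1 ≤ N) (hl : Pl ≤ Pi) (hl' : Pl' + pM = Pl) (hM : p ≤ pM)
    (h : Pi' ≤ max Pe Pl') : Pi' + 1 ≤ Pi := by
  rcases le_total Pe Pl' with hc | hc
  · rw [max_eq_right hc] at h; omega
  · rw [max_eq_left hc] at h; omega

/-- K13b: the free-point case (only the new line through `x′`). -/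
theorem K13_descent_free (Pi Pi' N Pe : ℕ) (hN : N ≤ Pi) (he : Pe + 1 ≤ N) (h : Pi' ≤ Pe) :
    Pi' + 1 ≤ Pi := by omega

/-- K13c: there is no infinite strictly decreasing sequence of natural numbers — the loop (B′-chain⁺)
is finite (memo 2.5). -/
theorem K13_no_infinite_descent (a : ℕ → ℕ) (h : ∀ k, a (k + 1) + 1 ≤ a k) : False := by
  have key : ∀ k, a k + k ≤ a 0 := by
    intro k
    induction k with
    | zero => simp
    | succ k ih => have := h k; omega
  have := key (a 0 + 1)
  omega

/-- K13d: quantitative form — a chain `a 0, …, a K` with unit drops and all terms `≥ p` before the last has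
`K + p ≤ a 0 + 1` (memo 2.6 (Bound), with `a = Π`). -/
theorem K13_length_bound (a : ℕ → ℕ) (K p : ℕ) (h : ∀ k, k < K → a (k + 1) + 1 ≤ a k)
    (hge : ∀ k, k < K → p ≤ a k) (hK : 1 ≤ K) : K + p ≤ a 0 + 1 := by
  have key : ∀ k, k ≤ K → a k + k ≤ a 0 := by
    intro k
    induction k with
    | zero => intro _; simp
    | succ k ih => intro hk; have := h k (by omega); have := ih (by omega); omega
  have h1 := key (K - 1) (by omega)
  have h2 := hge (K - 1) (by omega)
  omega

end K13

/-! ### K14: degree of the derivative when `p ∣ N` (memo 2.2 b, 2.4 ii) -/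
section K14
variable {K : Type*} [Field K] (p : ℕ) [hp : Fact p.Prime] [CharP K p]

omit hp in
/-- K14a: `natDegree f ≤ N` and `p ∣ N` ⇒ `natDegree f′ ≤ N − 2` (the `X^{N−1}` term of `f′` carries the factor `N = 0`). -/
theorem K14_natDegree_derivative_le (f : K[X]) (N : ℕ) (hdvd : p ∣ N) (hf : f.natDegree ≤ N) :
    (derivative f).natDegree ≤ N - 2 := by
  rw [Polynomial.natDegree_le_iff_coeff_eq_zero]
  intro n hn
  rw [coeff_derivative]
  by_cases h : n + 1 = N
  · have hc : ((n : K) + 1) = ((N : ℕ) : K) := by rw [← h]; push_cast; ring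
    rw [hc, (CharP.cast_eq_zero_iff K p N).mpr hdvd, mul_zero]
  · have : f.coeff (n + 1) = 0 := Polynomial.coeff_eq_zero_of_natDegree_lt (by omega)
    rw [this, zero_mul]

omit hp in
/-- K14b: hence every root of `f′ ≠ 0` has multiplicity `≤ N − 2`, i.e. `1 + ord_z f′ ≤ N − 1`:
the bound `Π_{e_x}(x′) ≤ N*(x) − 1` of memo 2.4 (ii). -/
theorem K14_rootMultiplicity_derivative_le (f : K[X]) (N : ℕ) (hdvd : p ∣ N) (hf : f.natDegree ≤ N)
    (hne : derivative f ≠ 0) (a : K) : rootMultiplicity a (derivative f) ≤ N - 2 := by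
  have hdeg := K14_natDegree_derivative_le p f N hdvd hf
  have h1 := Polynomial.natDegree_le_of_dvd (Polynomial.pow_rootMultiplicity_dvd (derivative f) a) hne
  rw [(monic_X_sub_C a).natDegree_pow, natDegree_X_sub_C, mul_one] at h1
  exact h1.trans hdeg

/-- K14c: and if `f′` vanished to order `≥ N − 1` at a point it would be identically zero — the line would be
W-invariant and bear nothing (this is how Lemma F of g11 is recovered). -/
theorem K14_derivative_eq_zero_of_high_order (f : K[X]) (N : ℕ) (hN : 1 ≤ N) (hdvd : p ∣ N)
    (hf : f.natDegree ≤ N) (a : K) (h : (X - C a) ^ (N - 1) ∣ derivative f) : derivative f = 0 := by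
  by_contra hne
  have hdeg := K14_natDegree_derivative_le p f N hdvd hf
  have h1 := Polynomial.natDegree_le_of_dvd h hne
  rw [(monic_X_sub_C a).natDegree_pow, natDegree_X_sub_C, mul_one] at h1
  have hp2 : 2 ≤ p := hp.out.two_le
  have : 2 ≤ N := Nat.le_of_dvd (by omega) hdvd |>.trans' hp2
  omega

end K14

/-! ### K15: `p`-th power factors are constants for `d` (memo 2.3) -/
section K15
variable {S : Type*} [CommRing S] (p : ℕ) [CharP S p]

/-- K15a: `(g^p)′ = 0` in characteristic `p`. -/
theorem K15_derivative_pow_p (g : S[X]) : derivative (g ^ p) = 0 := by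
  rw [derivative_pow, CharP.cast_eq_zero S p, C_0, zero_mul, zero_mul]

/-- K15b: `(g^p · f)′ = g^p · f′` — multiplying the restricted radicand by `p`-th powers of local equations
(the factors `ε^p` acquired from later divisions and blow-ups) does not move or merge its critical points
away from their zeros. -/
theorem K15_derivative_pow_p_mul (f g : S[X]) : derivative (g ^ p * f) = g ^ p * derivative f := by
  rw [derivative_mul, K15_derivative_pow_p p g, zero_mul, zero_add]

/-- K15c: iterated: `(g^(p*m) · f)′ = g^(p*m) · f′`. -/
theorem K15_derivative_pow_pm_mul (f g : S[X]) (m : ℕ) :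
    derivative (g ^ (p * m) * f) = g ^ (p * m) * derivative f := by
  rw [pow_mul']
  exact K15_derivative_pow_p_mul p f (g ^ m)

end K15

/-! ### K16: over a perfect field, zero derivative means `p`-th power (memo 2.1/Δ3, contrapositive) -/
section K16
variable {K : Type*} [Field K] (p : ℕ) [hp : Fact p.Prime] [CharP K p] [PerfectRing K p]

/-- K16a: `f′ = 0 ⇒ f = g^p` for some `g` (perfect field of characteristic `p`).  Contrapositive: a
dehomogenised p-prepared initial form `P_N(1,s)`, being no `p`-th power, has `P_N′ ≢ 0` — so the
bearing level of a line carries finitely many critical points, of total multiplicity `≤ N − 2` (K14). -/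
theorem K16_pth_power_of_derivative_eq_zero (f : K[X]) (hf : derivative f = 0) :
    ∃ g : K[X], g ^ p = f := by
  refine ⟨Polynomial.map ((frobeniusEquiv K p).symm : K →+* K) (contract p f), ?_⟩
  have hcomp : (frobenius K p).comp ((frobeniusEquiv K p).symm : K →+* K) = RingHom.id K := by
    ext x
    simp
  rw [← Polynomial.map_frobenius_expand (p := p), ← Polynomial.map_expand, Polynomial.map_map, hcomp,
    Polynomial.map_id]
  exact expand_contract p hf hp.out.ne_zero

/-- K16b: conversely `(g^p)′ = 0`; so «`f` is a `p`-th power» ⇔ «`f′ = 0`» over a perfect field, and the set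
of lines that can ever bear a birth (memo 2.3, `𝓛(z)`) is read off the derivative of one fixed polynomial. -/
theorem K16_derivative_eq_zero_iff (f : K[X]) : derivative f = 0 ↔ ∃ g : K[X], g ^ p = f := by
  constructor
  · exact K16_pth_power_of_derivative_eq_zero p f
  · rintro ⟨g, rfl⟩
    rw [derivative_pow, CharP.cast_eq_zero K p, C_0, zero_mul, zero_mul]

end K16

end Summit.ResolutionOfSingularities.ResolutionOfSingularities.Cruxes.DescentPerfectToAll.NegationLens6g12
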